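import Literature.Geometry.Lorentzian.AFEndBreathingData
import Literature.Geometry.Lorentzian.AFEndBreathing
import Literature.Geometry.Lorentzian.TameGenericity
import Literature.Geometry.Lorentzian.Genericity
import Mathlib.Analysis.InnerProductSpace.Calculus
import HarnessLib

/-!
# For a suitable rate the member-wise breathed curve is IMMERSED at `0` (registered stub
`stub_breatheImmersed`, line `Sketch` = tame template breathe ∘ trim ∘ kick, crux
`EIHFluxBalance.ModulatedKerrHandoff`, item stmt-FinalStateConjecture-17402)

Let `F : ℝ¹ → InitialDataSet (𝓡 3) X` be a jointly smooth one-parameter family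
(`InitialDataSet.IsSmoothDataFamily`), `e` an asymptotically flat end of `X` and
`B : e.BreathingData z₀ 1` breathing data on the unit coordinate ball at `z₀`. For a rate `λ : ℝ`
the member-wise breathed curve is `c ↦ AFEnd.breatheFamily B (F c) (λ c₀) = (breathe (σ (λ c₀)))^* (F c)`.
We prove that for a suitable `λ` it is IMMERSED at `0` (`InitialDataSet.IsImmersedAtZero`): at the
centre `x₀ = Φₑ z₀` and for `v₀ = e₀ ≠ 0` the marker is

  `h_{F' c}(x₀)(v₀, v₀) = (1 + σ(λ c₀))² · g c`,  `g c := h_{F c}(x₀)(v₀, v₀)`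

(`AFEnd.breatheFamily_h_inner_center`); `g` is smooth (the jointly smooth family read in the
trivialisation of `TX` at `x₀`, `contMDiffAt_bilin_iff`), `g 0 > 0` (Riemannian positivity), and
`σ'(0) = s₀/π > 0`. By the product rule the derivative at `0` in the direction `v = v₀' e₀` is
`v₀' · (a + 2 σ'(0) λ g 0)` with `a := dg(0) e₀`; for `λ := (|a| + 1) / (2 σ'(0) g 0)` this is
`v₀' (a + |a| + 1) ≠ 0` whenever `v ≠ 0`.

Templates: `AFEnd.isImmersedAtZero_breatheCurve` (`TameBreathingCurve.lean`, the case `F` constant)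
and the marker computation of `Theorems/RobustClausewiseGenericityGaugeEnrichment`. Mathlib + the
Literature cone only; no definitions, no named facts. Christodoulou, CQG 16 (1999) A23, p. A24
(independent directions of a family); Lee, *Introduction to Smooth Manifolds* (2013), Prop. 2.25.
Stub-worker of the line lead prover-line-stmt-FinalStateConjecture-17402-0, 2026-08-17.
-/

-- the summit-side namespace `Summit.FinalStateConjecture.FinalStateConjecture.…` (summit = problem)
-- repeats a component by design, which the `dupNamespace` linter would flag on every decl.
set_option linter.dupNamespace false

noncomputable section

open scoped Manifold ContDiff Topology
open Bundle Filter Set Function TopologicalSpace Literature.Geometry.Lorentzian InitialDataSet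

namespace Summit.FinalStateConjecture.FinalStateConjecture.Theorems.EIHFluxBalance.TameTemplate

variable {X : Type} [TopologicalSpace X] [ChartedSpace E3 X] [IsManifold (𝓡 3) ∞ X]

/-- A scalar component `c ↦ h_{F c}(x₀)(v₀, w₀)` of a jointly smooth family of data, at a fixed
point and fixed tangent vectors, is a smooth function of the parameter: read the smooth section
`c ↦ (x₀, h_{F c}(x₀))` of the bundle of bilinear forms in the trivialisation of `TX` at `x₀`
(`contMDiffAt_bilin_iff`, `contMDiff_iff_contDiff`) and evaluate at the (constant) trivialised
vectors. Adapted from the block `hF` of `Theorems/RobustClausewiseGenericityGaugeEnrichment`. -/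
private theorem contDiff_h_inner_apply_of_isSmoothDataFamily {m : ℕ}
    {F : EuclideanSpace ℝ (Fin m) → InitialDataSet (𝓡 3) X} (hF : IsSmoothDataFamily m F)
    (x₀ : X) (v₀ w₀ : TangentSpace (𝓡 3) x₀) :
    ContDiff ℝ ∞ (fun c : EuclideanSpace ℝ (Fin m) ↦ (F c).h.inner x₀ v₀ w₀) := by
  set T := trivializationAt E3 (TangentSpace (𝓡 3) : X → Type _) x₀ with hT
  have h1 : ContMDiff 𝓘(ℝ, EuclideanSpace ℝ (Fin m)) ((𝓡 3).prod 𝓘(ℝ, E3 →L[ℝ] E3 →L[ℝ] ℝ)) ∞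
      (fun c : EuclideanSpace ℝ (Fin m) ↦ TotalSpace.mk' (E3 →L[ℝ] E3 →L[ℝ] ℝ)
        (E := fun x : X ↦ TangentSpace (𝓡 3) x →L[ℝ] TangentSpace (𝓡 3) x →L[ℝ] ℝ) x₀
        ((F c).h.inner x₀)) :=
    hF.1.comp (contMDiff_id.prodMk contMDiff_const)
  have h2 : ContMDiff 𝓘(ℝ, EuclideanSpace ℝ (Fin m)) 𝓘(ℝ, E3 →L[ℝ] E3 →L[ℝ] ℝ) ∞
      (fun c : EuclideanSpace ℝ (Fin m) ↦ (ContinuousLinearMap.precomp ℝ (T.symmL ℝ x₀)).comp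
        (((F c).h.inner x₀).comp (T.symmL ℝ x₀))) := fun c ↦
    ((contMDiffAt_bilin_iff (IX := 𝓘(ℝ, EuclideanSpace ℝ (Fin m))) (IB := 𝓡 3)
      (V := (TangentSpace (𝓡 3) : X → Type _)) (b := fun _ : EuclideanSpace ℝ (Fin m) ↦ x₀)
      (s := fun c : EuclideanSpace ℝ (Fin m) ↦ (F c).h.inner x₀) (x₀ := c)).1 (h1 c)).2
  have h3 : ContDiff ℝ ∞ (fun c : EuclideanSpace ℝ (Fin m) ↦
      (ContinuousLinearMap.precomp ℝ (T.symmL ℝ x₀)).comp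
        (((F c).h.inner x₀).comp (T.symmL ℝ x₀))) := contMDiff_iff_contDiff.1 h2
  have hx₀T : x₀ ∈ T.baseSet := FiberBundle.mem_baseSet_trivializationAt' x₀
  set u : E3 := T.continuousLinearMapAt ℝ x₀ v₀ with hu
  set u' : E3 := T.continuousLinearMapAt ℝ x₀ w₀ with hu'
  have hsu : T.symmL ℝ x₀ u = v₀ := T.symmL_continuousLinearMapAt hx₀T v₀
  have hsu' : T.symmL ℝ x₀ u' = w₀ := T.symmL_continuousLinearMapAt hx₀T w₀
  have h4 : (fun c : EuclideanSpace ℝ (Fin m) ↦ (F c).h.inner x₀ v₀ w₀) =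
      fun c ↦ ((ContinuousLinearMap.precomp ℝ (T.symmL ℝ x₀)).comp
        (((F c).h.inner x₀).comp (T.symmL ℝ x₀))) u u' := by
    funext c
    simp only [ContinuousLinearMap.coe_comp, Function.comp_apply,
      ContinuousLinearMap.precomp_apply, hsu, hsu']
  rw [h4]
  exact (h3.clm_apply contDiff_const).clm_apply contDiff_const

/-- **For a suitable rate the breathed curve is IMMERSED at `0`** (registered stub
`stub_breatheImmersed` of the line `Sketch` of the crux `EIHFluxBalance.ModulatedKerrHandoff`). For a
jointly smooth curve `F : ℝ¹ → data` and breathing data `B` on the unit coordinate ball at `z₀` of the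
end `e`, there is `λ : ℝ` with `c ↦ (breathe (σ (λ c₀)))^* (F c)` immersed at `0`: at the centre
`x₀ = Φₑ z₀`, `v₀ = e₀`, the marker is `(1 + σ(λ c₀))² · g c`, `g c = h_{F c}(x₀)(v₀, v₀)`
(`AFEnd.breatheFamily_h_inner_center`), with `g` smooth, `g 0 > 0`, `σ'(0) = s₀/π > 0`; its derivative
at `0` along `v = v₀' e₀` is `v₀' (a + 2σ'(0) λ g 0)`, `a = dg(0) e₀`, which for
`λ := (|a| + 1) / (2σ'(0) g 0)` equals `v₀' (a + |a| + 1) ≠ 0`. Christodoulou, CQG 16 (1999), p. A24;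
Lee 2013, Prop. 2.25. -/
theorem stub_breatheImmersed :
    ∀ (X : Type) [TopologicalSpace X] [ChartedSpace E3 X] [IsManifold (𝓡 3) ((⊤ : ℕ∞) : WithTop ℕ∞) X] [T2Space X] [SecondCountableTopology X] [ConnectedSpace X],
      ∀ (e : AFEnd X) (z₀ : E3) (B : e.BreathingData z₀ 1)
        (F : EuclideanSpace ℝ (Fin 1) → InitialDataSet (𝓡 3) X),
        IsSmoothDataFamily 1 F →
          ∃ lam : ℝ, IsImmersedAtZero 1 (fun c ↦ AFEnd.breatheFamily B (F c) (lam * c 0)) := by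
  intro X _ _ _ _ _ _ e z₀ B F hF
  -- the centre, a non-zero tangent vector there
  set x₀ : X := e.dataChartExt z₀ with hx₀
  set v₀ : TangentSpace (𝓡 3) x₀ := (EuclideanSpace.single (0 : Fin 3) (1 : ℝ) : E3) with hv₀
  have hv₀ne : v₀ ≠ 0 := by
    have h : (EuclideanSpace.single (0 : Fin 3) (1 : ℝ) : E3) ≠ 0 := by
      rw [← norm_ne_zero_iff, PiLp.norm_single, norm_one]
      exact one_ne_zero
    exact h
  -- the second factor of the marker: smooth, positive at `0`
  set g : EuclideanSpace ℝ (Fin 1) → ℝ := fun c ↦ (F c).h.inner x₀ v₀ v₀ with hg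
  have hgs : ContDiff ℝ ∞ g := contDiff_h_inner_apply_of_isSmoothDataFamily hF x₀ v₀ v₀
  have hg1 : ContDiff ℝ 1 g := hgs.of_le (by exact_mod_cast le_top)
  have hgd : HasFDerivAt g (fderiv ℝ g 0) 0 := (hg1.differentiable one_ne_zero 0).hasFDerivAt
  have hA : 0 < g 0 := (F 0).h.pos x₀ v₀ hv₀ne
  -- the slope of the squashing at `0`
  set s : ℝ := AFEnd.breatheScale B / Real.pi with hs
  have hs0 : 0 < s := div_pos (AFEnd.breatheScale_spec B).1 Real.pi_pos
  -- the unit direction of `ℝ¹`, the uncontrolled slope `a`, and the rate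
  set e₀ : EuclideanSpace ℝ (Fin 1) := EuclideanSpace.single (0 : Fin 1) (1 : ℝ) with he₀
  set a : ℝ := fderiv ℝ g 0 e₀ with ha
  set lam : ℝ := (|a| + 1) / (2 * s * g 0) with hlam
  have hlam_spec : 2 * s * g 0 * lam = |a| + 1 := by
    rw [hlam]
    field_simp
  refine ⟨lam, fun v hv ↦ ⟨x₀, v₀, v₀, Or.inl ?_⟩⟩
  -- the direction has a non-zero coordinate and is a multiple of `e₀`
  have hv0 : v 0 ≠ 0 := by
    intro h
    apply hv
    ext i
    fin_cases i
    simpa using h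
  have hve : v = v 0 • e₀ := by
    ext i
    fin_cases i
    simp [he₀]
  have hgv : fderiv ℝ g 0 v = v 0 * a := by
    conv_lhs => rw [hve]
    rw [map_smul, smul_eq_mul]
  -- the marker along the breathed curve is `(1 + σ(λ c₀))² · g c`
  have hline : (fun c : EuclideanSpace ℝ (Fin 1) ↦
      (AFEnd.breatheFamily B (F c) (lam * c 0)).h.inner x₀ v₀ v₀) =
      fun c ↦ (1 + AFEnd.squash B (lam * c 0)) ^ 2 * g c :=
    funext fun c ↦ AFEnd.breatheFamily_h_inner_center B (F c) (lam * c 0) v₀ v₀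
  -- derivative of the first factor
  have hsq : HasDerivAt (AFEnd.squash B) s 0 := by
    have h := (Real.hasDerivAt_arctan 0).const_mul (AFEnd.breatheScale B / Real.pi)
    simp only [ne_eq, OfNat.ofNat_ne_zero, not_false_eq_true, zero_pow, add_zero, div_one,
      mul_one] at h
    exact h
  have hmul : HasDerivAt (fun t : ℝ ↦ lam * t) lam 0 := by
    simpa using (hasDerivAt_id (0 : ℝ)).const_mul lam
  have hsq' : HasDerivAt (fun t : ℝ ↦ AFEnd.squash B (lam * t)) (s * lam) 0 := by
    have h0 : HasDerivAt (AFEnd.squash B) s (lam * 0) := by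
      rw [mul_zero]
      exact hsq
    exact h0.comp 0 hmul
  have hp1 : HasDerivAt (fun t : ℝ ↦ (1 + AFEnd.squash B (lam * t)) ^ 2)
      ((2 : ℕ) * (1 + AFEnd.squash B (lam * 0)) ^ (2 - 1) * (s * lam))
      ((fun c : EuclideanSpace ℝ (Fin 1) ↦ c 0) 0) :=
    (hsq'.const_add 1).pow 2
  have hproj : HasFDerivAt (𝕜 := ℝ) (fun c : EuclideanSpace ℝ (Fin 1) ↦ c 0)
      (PiLp.proj (𝕜 := ℝ) 2 (fun _ : Fin 1 ↦ ℝ) 0) 0 :=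
    PiLp.hasFDerivAt_apply 2 (0 : EuclideanSpace ℝ (Fin 1)) 0
  have hp : HasFDerivAt
      (fun c : EuclideanSpace ℝ (Fin 1) ↦ (1 + AFEnd.squash B (lam * c 0)) ^ 2)
      (((2 : ℕ) * (1 + AFEnd.squash B (lam * 0)) ^ (2 - 1) * (s * lam)) •
        PiLp.proj (𝕜 := ℝ) 2 (fun _ : Fin 1 ↦ ℝ) 0) 0 := by
    have hcomp0 := hp1.comp_hasFDerivAt (0 : EuclideanSpace ℝ (Fin 1)) hproj
    exact hcomp0
  -- product rule, then evaluate at `v`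
  have hm := hp.fun_mul hgd
  rw [hline, hm.fderiv]
  have hval : ((1 + AFEnd.squash B (lam * (0 : EuclideanSpace ℝ (Fin 1)) 0)) ^ 2 • fderiv ℝ g 0 +
      g 0 • ((((2 : ℕ) : ℝ) * (1 + AFEnd.squash B (lam * 0)) ^ (2 - 1) * (s * lam)) •
        PiLp.proj (𝕜 := ℝ) 2 (fun _ : Fin 1 ↦ ℝ) 0)) v = v 0 * (a + (|a| + 1)) := by
    rw [← hlam_spec]
    simp only [add_apply, FunLike.coe_smul, Pi.smul_apply, PiLp.proj_apply, smul_eq_mul, hgv,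
      PiLp.zero_apply, mul_zero, AFEnd.squash_zero, add_zero, one_pow, one_mul, Nat.cast_ofNat]
    ring
  rw [hval]
  have hpos : 0 < a + (|a| + 1) := by
    have := neg_abs_le a
    linarith
  exact mul_ne_zero hv0 hpos.ne'

end Summit.FinalStateConjecture.FinalStateConjecture.Theorems.EIHFluxBalance.TameTemplate

end
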